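import Summits.HodgeConjecture.CorCM.GaloisQuadraticPattern
import Summits.HodgeConjecture.CorCM.GaloisDegenerateRealQuadraticFactor
import HarnessLib

/-!
# BAD ascends along EVERY quadratic extension of a large Galois CM field, part II: the lift of a certificate through a kernel of
# order two WITHOUT a complement, by counting sections (`|G| ≤ 2^(|Q|/8)`)

COR-CM (cell `pub-hodgecm2`), binder seat b04 (gen 31), count-neutral own lane «Galois-CM-type classification»; sequel of
`CorCM/GaloisQuadraticPattern` (the pattern set, its CM property, annihilation and the twisted equations forced on a stabiliser) and
`CorCM/GaloisSectionCount` (the counting of sections).  KERNEL ONLY: theorems; no definition, no named fact, no `sorry`.  `HC_CM` is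
neither used nor claimed.

* `two_mul_card_cm` — `2|T₀| = |Q|` for a CM set.
* **`exists_liftQuadratic_certificate`** — `f : G →* Q` surjective, `ker f = {1, n₁}`, `c² = 1` with `f c` central, `Q` not of
  exponent `2`, `|G| ≤ 2^(|Q|/8)`, an annihilator certificate `(T₀, b₀)` for `(Q, f c)` ⟹ an annihilator certificate for `(G, c)`.
  Choice of `w`: `exists_forall_involution_translate_ne` gives `w₀` with `T₀w₀ ∉ {T₀, c₀T₀}`, i.e. `F(w₀), D₁(w₀) ≠ ∅`; since
  `F(c₀w₀) = D₁(w₀)` and `D₁(c₀w₀) = F(w₀)`, one of `w₀`, `c₀w₀` has `2|D₁| ≥ |T₀|`.  Then `V = {v : f v ∉ {1, c₀}, ψ_v(D₁) ⊆ D₁}`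
  has `|V| < |G| ≤ 2^(|Q|/8) ≤ 2^(|D₁| − |D₁|/2)`, so `SectionCount.exists_forall_violated` yields `ε`; the pattern set for
  `P(q) = s(q) n₁^{ε q}` is CM and annihilated (part I) and has trivial left stabiliser: `n₁`, `c`, `c n₁` by part I's geometry, any
  other `v` by `constraint_of_stabiliser` against the violated equation.
* **`exists_simple_degenerate_of_quadratic_quotient_certificate`** — Galois dress: `e : Gal(K/ℚ) ≃* G₀`, `f : G₀ →* Q₀` surjective
  with kernel of order `2`, `|G₀| ≤ 2^(|Q₀|/8)`, `Q₀` not of exponent `2`, certificate for `(Q₀, f(e c))` ⟹ `K` carries a simple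
  degenerate abelian variety of dimension `|G₀|/2` with CM by `K`.
CONSEQUENCE (with `CorCM/GaloisCertificateQuotientLift` for index `≥ 3` and `CorCM/GaloisCertificateSplitTwo`/`…QuadraticSplit` for the
split index-`2` case): a certificate on ANY Galois CM quotient field `K₀` of `K` lifts to `K` — BAD(K₀) ⟹ BAD(K) — except possibly
when `[K:K₀] = 2`, the extension does not split through complex conjugation, and `2[K₀:ℚ] > 2^⌊[K₀:ℚ]/8⌋` (i.e. `[K₀:ℚ] ≤ 55`) or
`Gal(K₀/ℚ)` has exponent `2`; the `2`-groups with `[K:ℚ] ≤ 64` are covered by the seat's census (compute j224726: 9 020 non-split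
triples, all BAD).  «BAD» = a primitive degenerate CM type = an exceptional (non-divisor) Hodge class on a power of a simple CM abelian
variety, whose algebraicity is open; «GOOD» = `B = D` for all powers of all simple CM abelian varieties with CM by the field.

## References

* [Kubota1965] T. Kubota, *On the field extension by complex multiplication*, Trans. AMS 118 (1965), §2, §4 Lemma 2.
* [Shimura1998] G. Shimura, *Abelian Varieties with Complex Multiplication and Modular Functions*, §6.2 Thm. 3, §8.2 Prop. 26.
* [Gordon1999HodgeAVSurvey] B. B. Gordon, *A survey of the Hodge conjecture for abelian varieties*, Thm. 6.4, §9.3.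
-/

noncomputable section

open CategoryTheory CategoryTheory.Limits NumberField
open scoped BigOperators

namespace Summit.HodgeConjecture.CorCM.GaloisModels

open Literature.NumberTheory.ComplexMultiplication
open Literature.AlgebraicGeometry.Motives (AbelianVariety CMType)
open Literature.AlgebraicGeometry.HodgeTheory
open Literature.AlgebraicGeometry.ComplexMultiplication (IsCMTypeRealisation)
open Literature.AlgebraicGeometry.Pohlmann1968
open Literature.Barriers.HodgeConjecture (divisorClassesSpan)

namespace QuadraticLift

section Model

variable {G Q : Type*} [Group G] [Group Q] {f : G →* Q} {n₁ : G}
variable [Fintype G] [DecidableEq G] [Fintype Q] [DecidableEq Q]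

/-! ## §3 The lift -/

omit [Fintype G] [DecidableEq G] in
/-- `2 |T₀| = |Q|` for a CM set `T₀` (its complement is `c₀ T₀`). [folklore] -/
theorem two_mul_card_cm (c₀ : Q) (T₀ : Finset Q) (hcm : ∀ q : Q, q ∈ T₀ ↔ c₀ * q ∉ T₀) :
    2 * T₀.card = Fintype.card Q := by
  classical
  have himg : Finset.univ \ T₀ = T₀.image fun q => c₀ * q := by
    ext q
    simp only [Finset.mem_sdiff, Finset.mem_univ, true_and, Finset.mem_image]
    constructor
    · intro hq
      refine ⟨c₀⁻¹ * q, (hcm _).2 (by rwa [mul_inv_cancel_left]), mul_inv_cancel_left _ _⟩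
    · rintro ⟨t, ht, rfl⟩; exact (hcm t).1 ht
  have h1 := Finset.card_sdiff_add_card_eq_card (Finset.subset_univ T₀)
  rw [himg, Finset.card_image_of_injective _ (mul_right_injective c₀), Finset.card_univ] at h1
  omega

/-- **THE LIFT THROUGH A KERNEL OF ORDER TWO, NO SPLITTING** (size condition `|G| ≤ 2^(|Q|/8)`): `f : G →* Q` surjective with
`ker f = {1, n₁}`, `c ∈ G` with `c² = 1` and `f c` central, `Q` not of exponent `2`, an annihilator certificate `(T₀, b₀)` for
`(Q, f c)` ⟹ an annihilator certificate for `(G, c)`. [cite: Kubota1965, §2] [cite: Shimura1998, §8.2 Prop. 26] -/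
theorem exists_liftQuadratic_certificate (hf : Function.Surjective f) (hn₁ : f n₁ = 1) (h₁ : n₁ ≠ 1)
    (hker : ∀ n : G, f n = 1 → n = 1 ∨ n = n₁) (c : G) (hcc : c * c = 1) (hcomm : ∀ q : Q, f c * q = q * f c)
    (T₀ : Finset Q) (hcm : ∀ q : Q, q ∈ T₀ ↔ f c * q ∉ T₀)
    (hprim : ∀ v : Q, v ≠ 1 → ∃ w : Q, ¬ (w ∈ T₀ ↔ v * w ∈ T₀)) (b₀ : Q → ℤ) (hanti : ∀ q, b₀ (f c * q) = -b₀ q)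
    (hann : ∀ g : Q, ∑ q ∈ T₀, b₀ (q * g) = 0) (hb : ∃ q, b₀ q ≠ 0) (hexp : ∃ g : Q, g * g ≠ 1)
    (hbig : Fintype.card G ≤ 2 ^ (Fintype.card Q / 8)) :
    ∃ (S : Finset G) (b : G → ℤ), (∀ x : G, x ∈ S ↔ c * x ∉ S) ∧
      (∀ v : G, v ≠ 1 → ∃ w : G, ¬ (w ∈ S ↔ v * w ∈ S)) ∧ (∀ x, b (c * x) = -b x) ∧
      (∀ g : G, ∑ x ∈ S, b (x * g) = 0) ∧ ∃ x, b x ≠ 0 := by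
  classical
  have hs : ∀ q, f (Function.surjInv hf q) = q := Function.surjInv_eq hf
  set s := Function.surjInv hf with hs_def
  have hcen := SplitExtension.kerTwo_comm hn₁ h₁ hker
  have hinv := SplitExtension.kerTwo_mul_self hn₁ h₁ hker
  have hcc' : f c * f c = 1 := by rw [← map_mul, hcc, map_one]
  have hT₀ := two_mul_card_cm (f c) T₀ hcm
  -- STEP B: the construction for a good `w`
  have key : ∀ w : Q, (∃ q, q ∈ T₀ ∧ q * w⁻¹ ∈ T₀) → (∃ q, q ∈ T₀ ∧ q * w⁻¹ ∉ T₀) →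
      T₀.card ≤ 2 * (T₀.filter fun q => q * w⁻¹ ∉ T₀).card →
      ∃ (S : Finset G) (b : G → ℤ), (∀ x : G, x ∈ S ↔ c * x ∉ S) ∧
        (∀ v : G, v ≠ 1 → ∃ w : G, ¬ (w ∈ S ↔ v * w ∈ S)) ∧ (∀ x, b (c * x) = -b x) ∧
        (∀ g : G, ∑ x ∈ S, b (x * g) = 0) ∧ ∃ x, b x ≠ 0 := by
    intro w hF hD hcard
    set D₁ := T₀.filter fun q => q * w⁻¹ ∉ T₀ with hD₁
    have hmemD₁ : ∀ q, q ∈ D₁ ↔ q ∈ T₀ ∧ q * w⁻¹ ∉ T₀ := fun q => by rw [hD₁, Finset.mem_filter]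
    -- the constraint data
    set ψt : G → Q → Q := fun v z => if f v * z ∈ T₀ then f v * z else f c * (f v * z) with hψt
    set τt : G → Q → Bool := fun v z => if f v * z ∈ T₀ then decide (v * s z ≠ s (f v * z))
      else xor (xor (decide (v * s z ≠ s (f v * z))) (decide (c * s (f c * (f v * z)) ≠ s (f v * z)))) true with hτt
    set V := Finset.univ.filter fun v : G => f v ≠ 1 ∧ f v ≠ f c ∧ ∀ z ∈ D₁, ψt v z ∈ D₁ with hV
    have hmemV : ∀ v, v ∈ V ↔ f v ≠ 1 ∧ f v ≠ f c ∧ ∀ z ∈ D₁, ψt v z ∈ D₁ := fun v => by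
      rw [hV, Finset.mem_filter, and_iff_right (Finset.mem_univ v)]
    set ψ : G → D₁ → D₁ := fun v z => if h : ψt v z.1 ∈ D₁ then ⟨ψt v z.1, h⟩ else z with hψ
    set τ : G → D₁ → Bool := fun v z => τt v z.1 with hτ
    have hψv : ∀ v ∈ V, ∀ z : D₁, (ψ v z : Q) = ψt v z.1 := fun v hv z => by
      have h := ((hmemV v).1 hv).2.2 z.1 z.2
      simp only [hψ, dif_pos h]
    have hψt_cases : ∀ v z, ψt v z = f v * z ∨ ψt v z = f c * (f v * z) := fun v z => by
      simp only [hψt]; split_ifs <;> simp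
    have hinjψ : ∀ v ∈ V, Function.Injective (ψ v) := by
      intro v hv z₁ z₂ h
      have h' : ψt v z₁.1 = ψt v z₂.1 := by rw [← hψv v hv z₁, ← hψv v hv z₂, h]
      apply Subtype.ext
      have hz₁ := ((hmemD₁ _).1 z₁.2).1
      have hz₂ := ((hmemD₁ _).1 z₂.2).1
      simp only [hψt] at h'
      by_cases e₁ : f v * z₁.1 ∈ T₀ <;> by_cases e₂ : f v * z₂.1 ∈ T₀ <;> simp only [e₁, e₂, if_true, if_false] at h'
      · exact mul_left_cancel h'
      · -- `f v z₁ = c₀ f v z₂` ⟹ `z₁ = c₀ z₂`, impossible inside `T₀`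
        have : (z₁ : Q) = f c * z₂ := by
          apply mul_left_cancel (a := f v)
          rw [h', hcomm, mul_assoc, ← hcomm]
        exact absurd hz₁ (this ▸ (hcm _).1 hz₂)
      · have : (z₂ : Q) = f c * z₁ := by
          apply mul_left_cancel (a := f v)
          rw [← h', hcomm, mul_assoc, ← hcomm]
        exact absurd hz₂ (this ▸ (hcm _).1 hz₁)
      · exact mul_left_cancel (mul_left_cancel h')
    have hfixψ : ∀ v ∈ V, ∀ z : D₁, ψ v z ≠ z := by
      intro v hv z h
      have hv' := (hmemV v).1 hv
      have h' : ψt v z.1 = z.1 := by rw [← hψv v hv z, h]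
      simp only [hψt] at h'
      split_ifs at h' with e
      · exact hv'.1 (mul_right_cancel (h'.trans (one_mul (z : Q)).symm))
      · apply hv'.2.1
        have h2 : f c * f v = 1 := by
          have := mul_right_cancel ((mul_assoc (f c) (f v) (z : Q)).trans (h'.trans (one_mul (z : Q)).symm))
          exact this
        calc f v = f c * (f c * f v) := by rw [← mul_assoc, hcc', one_mul]
          _ = f c := by rw [h2, mul_one]
    -- sizes
    have hd : Fintype.card D₁ = D₁.card := Fintype.card_coe D₁
    have hV1 : (1 : G) ∉ V := fun h => ((hmemV 1).1 h).1 (map_one f)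
    have hVlt : V.card < Fintype.card G := by
      calc V.card < (Finset.univ : Finset G).card :=
            Finset.card_lt_card ⟨Finset.subset_univ V, fun h => hV1 (h (Finset.mem_univ 1))⟩
        _ = Fintype.card G := Finset.card_univ
    have hbig' : V.card * 2 ^ (Fintype.card D₁ / 2) < 2 ^ Fintype.card D₁ := by
      rw [hd]
      have hQ : Fintype.card Q ≤ 4 * D₁.card := by omega
      have h8 : Fintype.card Q / 8 ≤ D₁.card - D₁.card / 2 := by omega
      calc V.card * 2 ^ (D₁.card / 2) < Fintype.card G * 2 ^ (D₁.card / 2) :=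
            mul_lt_mul_of_pos_right hVlt (pow_pos two_pos _)
        _ ≤ 2 ^ (D₁.card - D₁.card / 2) * 2 ^ (D₁.card / 2) :=
            Nat.mul_le_mul_right _ (hbig.trans (Nat.pow_le_pow_right two_pos h8))
        _ = 2 ^ D₁.card := by rw [← pow_add, Nat.sub_add_cancel (Nat.div_le_self _ _)]
    obtain ⟨ε, hε⟩ := SectionCount.exists_forall_violated V ψ hinjψ hfixψ τ hbig'
    -- the points and the pattern set
    set εt : Q → Bool := fun q => if h : q ∈ D₁ then ε ⟨q, h⟩ else false with hεt
    have hεt : ∀ z : D₁, εt z.1 = ε z := fun z => by simp only [hεt, dif_pos z.2]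
    set S := Finset.univ.filter fun x : G => (f x ∈ T₀ ∧ f x * w⁻¹ ∈ T₀) ∨
      (f x ∈ T₀ ∧ f x * w⁻¹ ∉ T₀ ∧ x = s (f x) * if εt (f x) then n₁ else 1) ∨
      (f x ∉ T₀ ∧ f x * w⁻¹ ∈ T₀ ∧ x = c * (s (f c * f x) * if εt (f c * f x) then n₁ else 1) * n₁) with hSdef
    have hS : ∀ x, x ∈ S ↔ (f x ∈ T₀ ∧ f x * w⁻¹ ∈ T₀) ∨
        (f x ∈ T₀ ∧ f x * w⁻¹ ∉ T₀ ∧ x = s (f x) * if εt (f x) then n₁ else 1) ∨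
        (f x ∉ T₀ ∧ f x * w⁻¹ ∈ T₀ ∧ x = c * (s (f c * f x) * if εt (f c * f x) then n₁ else 1) * n₁) := fun x => by
      rw [hSdef, Finset.mem_filter, and_iff_right (Finset.mem_univ x)]
    have hP : ∀ q, f (s q * if εt q then n₁ else 1) = q := fun q => by
      rw [map_mul, hs]; split_ifs <;> simp [hn₁]
    refine ⟨S, fun x => b₀ (f x), pattern_cm h₁ hker c hcc T₀ hcm w (fun q => s q * if εt q then n₁ else 1) hP S hS, ?_,
      fun x => by show b₀ (f (c * x)) = -b₀ (f x); rw [map_mul, hanti],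
      pattern_annihilated hs hn₁ h₁ hker c hcc T₀ b₀ hann w (fun q => s q * if εt q then n₁ else 1) hP S hS, ?_⟩
    · -- trivial left stabiliser
      intro v hv
      by_contra H
      have hstab : ∀ x, x ∈ S ↔ v * x ∈ S := fun x => by by_contra h; exact H ⟨x, h⟩
      by_cases hfv : f v = 1
      · -- `v = n₁` moves the point over `D₁`
        have hvn : v = n₁ := (hker v hfv).resolve_left hv
        obtain ⟨z, hz, hzw⟩ := hD
        have hpS : (s z * if εt z then n₁ else 1) ∈ S :=
          (hS _).2 (Or.inr (Or.inl ⟨by rw [hP]; exact hz, by rw [hP]; exact hzw, by rw [hP]⟩))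
        have hnot : v * (s z * if εt z then n₁ else 1) ∉ S := by
          rw [hvn, ← hcen]
          intro h
          rcases (hS _).1 h with ⟨-, h2⟩ | ⟨-, -, h3⟩ | ⟨h1', -, -⟩
          · rw [map_mul, hP, hn₁, mul_one] at h2; exact hzw h2
          · rw [map_mul, hP, hn₁, mul_one] at h3; exact ne_mul_ker h₁ _ h3.symm
          · rw [map_mul, hP, hn₁, mul_one] at h1'; exact h1' hz
        exact hnot ((hstab _).1 hpS)
      by_cases hfc : f v = f c
      · rcases fiber_two hker hfc with hvc | hvc
        · -- `v = c`
          have h1 := pattern_cm h₁ hker c hcc T₀ hcm w (fun q => s q * if εt q then n₁ else 1) hP S hS 1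
          have h2 := hstab 1
          rw [hvc] at h2
          exact (iff_iff_and_or_not_and_not.1 h2).elim (fun h => (h1.1 h.1) h.2) (fun h => h.1 (h1.2 h.2))
        · -- `v = c n₁` moves a full fibre over `F` onto an empty one
          obtain ⟨q, hq, hqw⟩ := hF
          have hxS : s q ∈ S := (hS _).2 (Or.inl ⟨by rw [hs]; exact hq, by rw [hs]; exact hqw⟩)
          have hfx : f (v * s q) = f c * q := by rw [hvc, map_mul, map_mul, hn₁, mul_one, hs]
          have hnot : v * s q ∉ S := by
            intro h
            rcases (hS _).1 h with ⟨h1', -⟩ | ⟨h1', -, -⟩ | ⟨-, h2', -⟩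
            · rw [hfx] at h1'; exact (hcm q).1 hq h1'
            · rw [hfx] at h1'; exact (hcm q).1 hq h1'
            · rw [hfx, mul_assoc] at h2'; exact (hcm _).1 hqw h2'
          exact hnot ((hstab _).1 hxS)
      · -- generic `v`: it lies in `V` and satisfies all equations — contradiction with the choice of `ε`
        have hcons : ∀ z, z ∈ T₀ → z * w⁻¹ ∉ T₀ →
            ψt v z ∈ T₀ ∧ ψt v z * w⁻¹ ∉ T₀ ∧ εt (ψt v z) = xor (εt z) (τt v z) := fun z hz hzw =>
          constraint_of_stabiliser hs hn₁ h₁ hker hinv c hcc T₀ hcm w εt S hS hstab hz hzw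
        have hvV : v ∈ V := by
          rw [hmemV]
          refine ⟨hfv, hfc, fun z hzD => ?_⟩
          rw [hmemD₁] at hzD ⊢
          obtain ⟨h1, h2, -⟩ := hcons z hzD.1 hzD.2
          exact ⟨h1, h2⟩
        obtain ⟨z, hzne⟩ := hε v hvV
        obtain ⟨hz, hzw⟩ := (hmemD₁ _).1 z.2
        obtain ⟨h1, h2, h3⟩ := hcons z.1 hz hzw
        apply hzne
        have e1 : ε (ψ v z) = εt (ψt v z.1) := by rw [← hεt (ψ v z), hψv v hvV z]
        rw [e1, ← hεt z, h3]
    · obtain ⟨q, hq⟩ := hb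
      exact ⟨s q, by show b₀ (f (s q)) ≠ 0; rw [hs]; exact hq⟩
  -- STEP A: a good `w` — from `exists_forall_involution_translate_ne`, or its `c₀`-translate
  obtain ⟨w₀, hw₀⟩ := SplitExtension.exists_forall_involution_translate_ne T₀ hprim hexp
  have hD₀ : ∃ q, q ∈ T₀ ∧ q * w₀⁻¹ ∉ T₀ := by
    obtain ⟨q, hq⟩ := hw₀ 1 (mul_one 1)
    rw [one_mul] at hq
    by_cases h : q ∈ T₀
    · exact ⟨q, h, fun h' => hq (iff_of_true h' h)⟩
    · have h' : q * w₀⁻¹ ∈ T₀ := not_not.1 fun h' => hq (iff_of_false h' h)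
      exact ⟨f c * q, not_not.1 fun h'' => h ((hcm q).2 h''), by rw [mul_assoc]; exact (hcm _).1 h'⟩
  have hF₀ : ∃ q, q ∈ T₀ ∧ q * w₀⁻¹ ∈ T₀ := by
    obtain ⟨q, hq⟩ := hw₀ (f c) hcc'
    by_cases h : q ∈ T₀
    · exact ⟨q, h, not_not.1 fun h' => hq (iff_of_false h' ((hcm q).1 h))⟩
    · have h1 : f c * q ∈ T₀ := not_not.1 fun h'' => h ((hcm q).2 h'')
      have h2 : q * w₀⁻¹ ∉ T₀ := fun h' => hq (iff_of_true h' h1)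
      exact ⟨f c * q, h1, by rw [mul_assoc]; exact not_not.1 fun h'' => h2 ((hcm (q * w₀⁻¹)).2 h'')⟩
  -- `q (c₀ w₀)⁻¹ = c₀ (q w₀⁻¹)`
  have hcw : ∀ q : Q, q * (f c * w₀)⁻¹ = f c * (q * w₀⁻¹) := fun q => by
    rw [mul_inv_rev, ← mul_assoc, hcomm, show (f c)⁻¹ = f c from inv_eq_of_mul_eq_one_right hcc', mul_assoc]
  have hswap : (T₀.filter fun q => q * (f c * w₀)⁻¹ ∉ T₀) = T₀.filter fun q => q * w₀⁻¹ ∈ T₀ := by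
    ext q
    simp only [Finset.mem_filter, hcw]
    exact ⟨fun ⟨hq, h⟩ => ⟨hq, (hcm (q * w₀⁻¹)).2 h⟩, fun ⟨hq, h⟩ => ⟨hq, (hcm (q * w₀⁻¹)).1 h⟩⟩
  by_cases hle : T₀.card ≤ 2 * (T₀.filter fun q => q * w₀⁻¹ ∉ T₀).card
  · exact key w₀ hF₀ hD₀ hle
  · refine key (f c * w₀) ?_ ?_ ?_
    · obtain ⟨q, hq, hqw⟩ := hD₀
      exact ⟨q, hq, by rw [hcw]; exact not_not.1 fun h => hqw ((hcm (q * w₀⁻¹)).2 h)⟩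
    · obtain ⟨q, hq, hqw⟩ := hF₀
      exact ⟨q, hq, by rw [hcw]; exact (hcm (q * w₀⁻¹)).1 hqw⟩
    · rw [hswap]
      have := Finset.card_filter_add_card_filter_not (s := T₀) (fun q => q * w₀⁻¹ ∈ T₀)
      omega

end Model

end QuadraticLift

/-! ## §4 The theorem for Galois CM fields -/

section Field

variable {K : Type} [Field K] [NumberField K] [IsCMField K] [IsGalois ℚ K]

/-- **A CERTIFIED-BAD QUOTIENT OF INDEX TWO MAKES A LARGE FIELD BAD — no splitting needed.**  `e : Gal(K/ℚ) ≃* G₀`,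
`f : G₀ →* Q₀` surjective with kernel `{1, n₁}`, `|G₀| ≤ 2^(|Q₀|/8)`, `Q₀` not of exponent `2`, and an annihilator certificate for
`(Q₀, f (e c))` ⟹ `K` carries a SIMPLE DEGENERATE abelian variety of dimension `|G₀|/2` with CM by `K` (rational `(p,p)` class
outside the divisor ring on some power). [cite: Kubota1965, §2 and §4 Lemma 2] [cite: Shimura1998, §6.2 Thm. 3 and §8.2 Prop. 26]
[cite: Gordon1999HodgeAVSurvey, Thm. 6.4 and §9.3] -/
theorem exists_simple_degenerate_of_quadratic_quotient_certificate {G₀ Q₀ : Type*} [Group G₀] [Fintype G₀] [DecidableEq G₀]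
    [Group Q₀] [Fintype Q₀] [DecidableEq Q₀] (e : (K ≃ₐ[ℚ] K) ≃* G₀) (f : G₀ →* Q₀) (hf : Function.Surjective f)
    {n₁ : G₀} (hn₁ : f n₁ = 1) (h₁ : n₁ ≠ 1) (hker : ∀ n : G₀, f n = 1 → n = 1 ∨ n = n₁)
    (hbig : Fintype.card G₀ ≤ 2 ^ (Fintype.card Q₀ / 8)) (hexp : ∃ g : Q₀, g * g ≠ 1) (c₀ : Q₀)
    (hc : f (e ((IsCMField.complexConj K).restrictScalars ℚ)) = c₀) (T₀ : Finset Q₀)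
    (hcm : ∀ q : Q₀, q ∈ T₀ ↔ c₀ * q ∉ T₀) (hprim : ∀ v : Q₀, v ≠ 1 → ∃ w : Q₀, ¬ (w ∈ T₀ ↔ v * w ∈ T₀))
    (b₀ : Q₀ → ℤ) (hanti : ∀ q, b₀ (c₀ * q) = -b₀ q) (hann : ∀ g : Q₀, ∑ q ∈ T₀, b₀ (q * g) = 0)
    (hb : ∃ q, b₀ q ≠ 0) :
    ∃ (Φ : CMType K) (φ₀ : K →+* ℂ) (X : AbelianVariety ℂ) (ι : 𝓞 K →+* End X)
      (ϑ : K →+* Module.End ℂ (complexBetti X.X 1)),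
      IsPrimitive (ℂ ≃+* ℂ) Φ.1 φ₀ ∧ ¬ IsNondegenerate Φ ∧ IsCMTypeRealisation Φ X ι ϑ ∧ X.IsSimple ∧
      X.dim = Fintype.card G₀ / 2 ∧
      ∃ m p : ℕ, ∃ y : complexBetti (⨁ fun _ : Fin m => X).X (2 * p), IsRationalClass y ∧
        IsOfHodgeType (⨁ fun _ : Fin m => X).dim (⨁ fun _ : Fin m => X).X (2 * p) p p y ∧
        y ∉ divisorClassesSpan (⨁ fun _ : Fin m => X).X (⨁ fun _ : Fin m => X).dim p := by
  subst hc
  set c := e ((IsCMField.complexConj K).restrictScalars ℚ) with hc_def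
  have hcc : c * c = 1 := GaloisRank.model_complexConj_mul_self e rfl
  have hcomm : ∀ q : Q₀, f c * q = q * f c := fun q => by
    obtain ⟨y, rfl⟩ := hf q
    rw [← map_mul, ← map_mul, GaloisRank.model_complexConj_comm e rfl y]
  obtain ⟨S, b, hcm', hprim', hanti', hann', hb'⟩ :=
    QuadraticLift.exists_liftQuadratic_certificate hf hn₁ h₁ hker c hcc hcomm T₀ hcm hprim b₀ hanti hann hb hexp hbig
  exact exists_simple_degenerate_of_model_annihilator e c rfl S hcm' hprim' b hanti' hann' hb'

/-- **BAD ASCENDS ALONG EVERY QUADRATIC EXTENSION OF A LARGE GALOIS CM FIELD (field form).**  `K ⊇ K₀ ⊇ ℚ` Galois CM with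
`[K : K₀] = 2`, `2[K₀:ℚ] ≤ 2^⌊[K₀:ℚ]/8⌋` (e.g. `[K₀:ℚ] ≥ 64`... precisely every `[K₀:ℚ] ≥ 56`... as a hypothesis), `Gal(K₀/ℚ)` not of
exponent `2`, and `K₀` has a PRIMITIVE DEGENERATE CM type ⟹ `K` carries a SIMPLE DEGENERATE abelian variety of dimension `[K:ℚ]/2`
with CM by `K` — NO splitting hypothesis. [cite: Kubota1965, §2 and §4 Lemma 2] [cite: Shimura1998, §6.2 Thm. 3 and §8.2 Prop. 26]
[cite: Gordon1999HodgeAVSurvey, Thm. 6.4 and §9.3] -/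
theorem exists_simple_degenerate_of_subfield_two_large (K₀ : Type) [Field K₀] [NumberField K₀] [IsCMField K₀] [IsGalois ℚ K₀]
    [Algebra K₀ K] [IsScalarTower ℚ K₀ K] (hdeg : Module.finrank K₀ K = 2)
    (hbig : 2 * Module.finrank ℚ K₀ ≤ 2 ^ (Module.finrank ℚ K₀ / 8)) (hexp : ∃ g : K₀ ≃ₐ[ℚ] K₀, g * g ≠ 1)
    (Φ₀ : CMType K₀) (φ₀ : K₀ →+* ℂ) (hprim : IsPrimitive (ℂ ≃+* ℂ) Φ₀.1 φ₀) (hndg : ¬ IsNondegenerate Φ₀) :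
    ∃ (Φ : CMType K) (φ : K →+* ℂ) (X : AbelianVariety ℂ) (ι : 𝓞 K →+* End X)
      (ϑ : K →+* Module.End ℂ (complexBetti X.X 1)),
      IsPrimitive (ℂ ≃+* ℂ) Φ.1 φ ∧ ¬ IsNondegenerate Φ ∧ IsCMTypeRealisation Φ X ι ϑ ∧ X.IsSimple ∧
      X.dim = Module.finrank ℚ K / 2 ∧
      ∃ m p : ℕ, ∃ y : complexBetti (⨁ fun _ : Fin m => X).X (2 * p), IsRationalClass y ∧
        IsOfHodgeType (⨁ fun _ : Fin m => X).dim (⨁ fun _ : Fin m => X).X (2 * p) p p y ∧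
        y ∉ divisorClassesSpan (⨁ fun _ : Fin m => X).X (⨁ fun _ : Fin m => X).dim p := by
  classical
  obtain ⟨τ, hτ, hker⟩ := eq_one_or_eq_of_restrictNormalHom_eq_one K₀ hdeg
  have hone : ((1 : K ≃ₐ[K₀] K).restrictScalars ℚ : K ≃ₐ[ℚ] K) = 1 := AlgEquiv.ext fun x => rfl
  have h₁ : (τ.restrictScalars ℚ : K ≃ₐ[ℚ] K) ≠ 1 := fun h =>
    hτ (AlgEquiv.restrictScalars_injective ℚ (h.trans hone.symm))
  have hn₁ := restrictNormalHom_restrictScalars_eq_one K₀ τ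
  obtain ⟨T₀, b, -, hcm, hprim', hanti, hann, hb⟩ :=
    exists_certificate_of_not_isNondegenerate (MulEquiv.refl (K₀ ≃ₐ[ℚ] K₀))
      (c₀ := (IsCMField.complexConj K₀).restrictScalars ℚ) rfl Φ₀ φ₀ hprim hndg
  have hbig' : Fintype.card (K ≃ₐ[ℚ] K) ≤ 2 ^ (Fintype.card (K₀ ≃ₐ[ℚ] K₀) / 8) := by
    rw [GaloisRank.card_model_eq_finrank (MulEquiv.refl (K ≃ₐ[ℚ] K)), GaloisRank.card_model_eq_finrank (MulEquiv.refl _),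
      ← Module.finrank_mul_finrank ℚ K₀ K, hdeg, mul_comm]
    exact hbig
  obtain ⟨Φ, φ, X, ι, ϑ, H1, H2, H3, H4, H5, H6⟩ :=
    exists_simple_degenerate_of_quadratic_quotient_certificate (MulEquiv.refl (K ≃ₐ[ℚ] K)) (AlgEquiv.restrictNormalHom K₀)
      (AlgEquiv.restrictNormalHom_surjective K) hn₁ h₁ hker hbig' hexp ((IsCMField.complexConj K₀).restrictScalars ℚ)
      (by rw [MulEquiv.refl_apply, restrictNormalHom_complexConj_of_tower K₀]) T₀ hcm hprim' b hanti hann hb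
  refine ⟨Φ, φ, X, ι, ϑ, H1, H2, H3, H4, ?_, H6⟩
  rw [H5, GaloisRank.card_model_eq_finrank (MulEquiv.refl (K ≃ₐ[ℚ] K))]

end Field

end Summit.HodgeConjecture.CorCM.GaloisModels

end
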